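import Summits.AtomisticToContinuum.HydrodynamicLimit.Theorems.BoxDissipativeWeakStrongEntropyAdmissibilityDynamicCore
import Summits.AtomisticToContinuum.HydrodynamicLimit.Theorems.HydroLimitInBand.Negative.LoadBearing
import Literature.Analysis.FunctionSpaces.TorusSpaceTimeComposition

/-!
# Crux `EntropyAdmissibility` (stmt-AtomisticToContinuum-9903), line `registered` — stub `stub_globalClampedHTheoremNecessary`

A NECESSARY condition of the crux, typed as the sharpest honest target for ideation / disproof (continuation lead c1,
PROMOTE dossier item 2): the **global clamped H-theorem in mean**. Testing the crux with SPACE-HOMOGENEOUS test functions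
`φ(t,x) = χ(t)` kills the flux term (`∇φ = 0`), and the dynamic part of the clamp-renormalised entropy balance becomes

  `A_N = ∫_{(0,τ]} χ'(t) S_N(t) dt − χ(τ) S_N(τ)`,   `S_N(t)(z) = ∫ ρ̂_N(t,z,x) Z_{a,b}(ŝ_N(t,z,x)) dx`

(the clamped COARSE-GRAINED entropy of the box fields at time `t`). So the crux implies, in its own frame,

  `GCH :  ∀ χ smooth, χ ≥ 0 on [0,τ]:  ∀ ε > 0, eventually  E_{P_N}[∫_{(0,τ]} χ' S_N dt − χ(τ) S_N(τ)] + χ(0) S(0) ≤ ε`,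

`S(0) = ∫ ρ₀ Z_{a,b}(s₀) dx` the clamped entropy of the Euler data. With `χ` increasing on `[t₁,t₂] ⊂ (0,τ)` and constant
afterwards this reads `E S_N(τ) ≥ (χ'-weighted mean of E S_N over [t₁,t₂]) − o(1)`: asymptotic MONOTONICITY of the expected
clamped coarse-grained entropy between two POSITIVE times, for a deterministic hard-sphere gas started from local Gibbs data
— an (annealed, clamped, coarse-grained) H-theorem, for which no tool is known (the Gibbs variational principle restarts only
at `t = 0`, where the law is local Gibbs). Proved here: `S1b → GCH` (instantiation at `φ = χ ∘ fst`, `∇φ = 0`) and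
`crux → GCH` (through the landed `crux → DynCore → S1b`, `EABirthCore`). Refuting GCH refutes the crux.
(Reused: `HydroLimitInBandNegative.torusGradient_const` for `∇` of a constant, `Torus.isSmoothSpaceTimeOn_of_time` for the
smoothness of `χ ∘ fst`.)

References: H. Spohn, *Large Scale Dynamics of Interacting Particles* (1991), Part I Ch. 3; J. Březina, E. Feireisl,
J. Math. Soc. Japan 70 (2018), Def. 2.9.
-/

noncomputable section

open MeasureTheory Filter Set
open scoped ENNReal Topology ContDiff

namespace Summit.AtomisticToContinuum.HydrodynamicLimit.Theorems.EABirthGCH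

open Literature.MathematicalPhysics.KineticTheory
open Literature.Analysis.FluidPDE.CompressibleEuler (clamp)
open Summit.AtomisticToContinuum.HydrodynamicLimit.Theses
open Summit.AtomisticToContinuum.HydrodynamicLimit.Theorems.BDWS
open Literature.Analysis.FluidPDE (Config HardSphereFlow)
open Literature.Analysis.FunctionSpaces

/-! ## Space-homogeneous test functions -/

/-- The clamped COARSE-GRAINED entropy of the box fields at time `t`: `S_N(t)(z) = ∫ ρ̂ Z_{a,b}(ŝ) dx`. -/
def coarseEntropy (σ η₁ : ℝ) (ℓ : ℕ → ℝ) (Φ : FlowFamily σ) (a b : ℝ) (N : ℕ) (t : ℝ)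
    (z : Config (N + 1) (Fin 3) T3) : ℝ :=
  ∫ x, boxDensity σ ℓ Φ N t z x * boxClampedEntropy σ η₁ ℓ Φ a b N t z x

/-- **The dynamic part at a space-homogeneous test function** `φ(t,x) = χ(t)`:
`A_N = ∫_{(0,τ]} S_N(t) χ'(t) dt − S_N(τ) χ(τ)` (the flux term vanishes). -/
theorem dynPart_homogeneous (σ η₁ T : ℝ) (ℓ : ℕ → ℝ) (Φ : FlowFamily σ) (τ a b : ℝ) (χ : ℝ → ℝ) (N : ℕ)
    (z : Config (N + 1) (Fin 3) T3) :
    dynPart σ η₁ T ℓ Φ τ a b (fun t _ => χ t) N z =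
      (∫ t in Ioc 0 τ, coarseEntropy σ η₁ ℓ Φ a b N t z * derivWithin χ (Ico 0 T) t) -
        coarseEntropy σ η₁ ℓ Φ a b N τ z * χ τ := by
  simp only [dynPart, coarseEntropy, Torus.timeDerivWithin, HydroLimitInBandNegative.torusGradient_const, inner_zero_right,
    mul_zero, add_zero, integral_mul_const]

/-- **The initial limit at a space-homogeneous test function**: `B = S(0) χ(0)`. -/
theorem initLimit_homogeneous (σ η₁ : ℝ) (ρ θ : ℝ → T3 → ℝ) (a b : ℝ) (χ : ℝ → ℝ) :
    initLimit σ η₁ ρ θ a b (fun t _ => χ t) =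
      (∫ x, ρ 0 x * clamp a b (cutEntropy σ η₁ (ρ 0 x) (θ 0 x))) * χ 0 := by
  simp only [initLimit, integral_mul_const]

/-! ## The global clamped H-theorem in mean -/

/-- **GCH — the global clamped H-theorem in mean** (necessary for the crux; open). In the crux's frame, for every smooth
`χ ≥ 0` on `[0,τ]`: `∀ ε > 0`, eventually
`E_{P_N}[∫_{(0,τ]} S_N(t) χ'(t) dt − S_N(τ) χ(τ)] + S(0) χ(0) ≤ ε` — asymptotic monotonicity of the expected clamped
coarse-grained entropy `t ↦ E S_N(t)` between positive times. -/
def Sig.globalClampedHTheorem : Prop :=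
  BoxDissipativeWeakStrong.HsEosLowDensity →
    ∃ ηc : ℝ, 0 < ηc ∧ ∀ η₁ : ℝ, 0 < η₁ → η₁ < ηc →
      ∀ (a₀ θ₀ : T3 → ℝ) (u₀ : T3 → V3), Continuous a₀ → Continuous θ₀ → Continuous u₀ →
        (∀ x, 0 < a₀ x) → (∀ x, 0 < θ₀ x) →
        ∃ σ₀ : ℝ, 0 < σ₀ ∧ ∀ σ : ℝ, 0 < σ → σ < σ₀ →
          ∀ (T : ℝ) (ρ θ : ℝ → T3 → ℝ) (u : ℝ → T3 → V3), IsHardSphereEulerSolution σ T ρ u θ →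
            (∀ t ∈ Ico 0 T, ∀ x, ρ t x * σ ^ 3 ≤ η₁ / 2) →
            ∀ Φ : FlowFamily σ,
              TendstoHydroFieldsAt (fun N => localGibbsLaw σ a₀ u₀ θ₀ N (Φ N)) Φ ρ u θ 0 →
              ∀ ℓ : ℕ → ℝ, (∀ N, 0 < ℓ N ∧ ℓ N ≤ 1) → Tendsto ℓ atTop (𝓝 0) →
                Tendsto (fun N : ℕ => ℓ N ^ 3 * ((N : ℝ) + 1)) atTop atTop →
                ∀ τ ∈ Ico 0 T, ∀ a b : ℝ, a < b → ∀ χ : ℝ → ℝ, ContDiffOn ℝ ∞ χ (Ico 0 T) →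
                  (∀ t ∈ Icc 0 τ, 0 ≤ χ t) →
                  ∀ ε : ℝ, 0 < ε → ∀ᶠ N : ℕ in atTop,
                    (∫ z, ((∫ t in Ioc 0 τ, coarseEntropy σ η₁ ℓ Φ a b N t z * derivWithin χ (Ico 0 T) t) -
                        coarseEntropy σ η₁ ℓ Φ a b N τ z * χ τ) ∂(localGibbsLaw σ a₀ u₀ θ₀ N (Φ N))) +
                      (∫ x, ρ 0 x * clamp a b (cutEntropy σ η₁ (ρ 0 x) (θ 0 x))) * χ 0 ≤ ε

/-- **S1b ⇒ GCH**: the annealed local entropy deficit bound at `φ(t,x) = χ(t)`. -/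
theorem globalClampedHTheorem_of_inFrame_def (h : EABirthCore.InFrame EABirthCore.Cdef) : Sig.globalClampedHTheorem := by
  intro hEos
  obtain ⟨ηc, hηc, H⟩ := h hEos
  refine ⟨ηc, hηc, fun η₁ hη₁ hη₁c a₀ θ₀ u₀ ha hθ hu ha0 hθ0 => ?_⟩
  obtain ⟨σ₀, hσ₀, G⟩ := H η₁ hη₁ hη₁c a₀ θ₀ u₀ ha hθ hu ha0 hθ0
  refine ⟨σ₀, hσ₀, fun σ hσ hσlt T ρ θ u hsol hguard Φ hLLN ℓ hℓ hℓ0 hℓ3 τ hτ a b hab χ hχ hχ0 ε hε => ?_⟩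
  have F := G σ hσ hσlt T ρ θ u hsol hguard Φ hLLN ℓ hℓ hℓ0 hℓ3 τ hτ a b hab (fun t _ => χ t)
    (Torus.isSmoothSpaceTimeOn_of_time hχ) (fun t ht _ => hχ0 t ht) ε hε
  simpa only [EABirthCore.Cdef, dynPart_homogeneous, initLimit_homogeneous] using F

/-! ## The stub -/

/-- **Signature of the registered stub `stub_globalClampedHTheoremNecessary`** (line `registered`, crux stmt-9903):
the crux implies the global clamped H-theorem in mean, and so does the open heart S1b (= `EABirthCore.InFrame EABirthCore.Cdef`,
definitionally the skeleton's `Sig.stub_meanEntropyDeficit`). -/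
def Sig.stub_globalClampedHTheoremNecessary : Prop :=
  (BoxDissipativeWeakStrong.EntropyAdmissibility → Sig.globalClampedHTheorem) ∧
    (EABirthCore.InFrame EABirthCore.Cdef → Sig.globalClampedHTheorem)

/-- **Registered stub `stub_globalClampedHTheoremNecessary`**: `crux → GCH` (through the landed `crux → DynCore → S1b`) and
`S1b → GCH`. -/
theorem stub_globalClampedHTheoremNecessary : Sig.stub_globalClampedHTheoremNecessary :=
  ⟨fun h => globalClampedHTheorem_of_inFrame_def
      (EABirthCore.inFrame_def_of_inFrame_dyn (EABirthCore.inFrame_dyn_of_crux h)),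
    globalClampedHTheorem_of_inFrame_def⟩

end Summit.AtomisticToContinuum.HydrodynamicLimit.Theorems.EABirthGCH

end
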